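import Mathlib.Algebra.Group.Subgroup.Map
import Mathlib.Data.PNat.Basic
import Mathlib.FieldTheory.AbsoluteGaloisGroup
import Mathlib.Topology.Algebra.OpenSubgroup
import Mathlib.Topology.Algebra.ContinuousMonoidHom
import Literature.AlgebraicGeometry.Frobenioids.Monoids
import Literature.AnabelianGeometry.SemiGraphs.TemperedCurves
import Literature.AnabelianGeometry.EtaleTheta.Conventions
import Literature.AnabelianGeometry.EtaleTheta.FreeMonoidPerfection

/-!
# [EtTh] §3 "Tempered Frobenioids", part 1: universal combinatorial coverings, log-divisors,
# log-meromorphic functions (Def. 3.1, Prop. 3.2) and tempered filters (Def. 3.3 (i), (ii))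

Source: S. Mochizuki, *The étale theta function …*, Publ. RIMS 45 (2009) [MochizukiEtTh2009],
§3, PDF pp. 69–73 (printed 295–299). Locators `p.N` = PDF page of the PRIMS text.

## The setting (pp.69–70) and how it is typed

"Let `L` be a finite extension of `ℚ_p`, with ring of integers `O_L` …; `𝔷^log` a stable log
curve over `𝔗^log`. Also, we assume that the special fiber of `𝔷` is split, and that the generic
fiber of the algebrization of `𝔷^log` is a smooth log curve. … The universal covering of the dual
graph of the special fiber of `𝔷^log` determines an infinite Galois étale covering
`𝔷^log_∞ → 𝔷^log`; such 'universal combinatorial coverings' appear in the theory of the tempered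
fundamental group [cf. [André], §4; [SemiAnbd], Example 3.10]." (p.69)

Formal log schemes, stable models and their divisors are not available (cell foundations audit,
plan/FOUNDATIONS.md rows 13–14: BLACKBOX / INTERFACE). Accordingly the object `Z^log_∞` is typed
as an **interface**: the structure `LogDivisorModel` packages exactly the monoids and maps that
Definition 3.1 names, and carries the three assertions of Proposition 3.2 — a *proved* published
result about an object we cannot construct — as hypothesis fields quoting print. Nothing asserts
that such a model exists; every later statement quantifies over the structure. Monoids are written
multiplicatively (as in `Literature/AlgebraicGeometry/Frobenioids/`): the text's `n · D` is
`D ^ n`, "`= 0`" is `= 1`, `M^gp` is `Algebra.GrothendieckGroup M`, `M^pf` is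
`Literature.AlgebraicGeometry.Frobenioids.Perfection M`.

ERRATUM E2 ([IUTchI] Rmk 3.2.4 (i)–(v), kurims pp.75–77, read on the page): Definition 3.1 (ii)
defines "log-meromorphic" by condition (c) "the divisor of zeroes and poles of `f` is a
log-divisor"; the proof of [EtTh] Prop. 4.2 (iii) uses condition (a) "for every `N ∈ ℕ_{≥1}`,
`f` admits an `N`-th root over some tempered covering of `Z^log`"; "(a) ⟹ (b) ⟺ (c)" and "it is
not clear to the author at the time of writing whether or not (c) [or (b)] implies (a)"; IUT adopts
approach (A): "log-meromorphic" := (a) ("tempered-meromorphic"). BOTH predicates are typed below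
(`LogDivisorModel.logMero` = printed (c), `LogDivisorModel.temperedMero` = IUT's (a)) with the
implication (a) ⟹ (c) as the field `temperedMero_le_logMero`.

v3 (two repairs; filer abc-iut-L2-d2 under the L2 succession rule for abc-iut-L2-t3, kit by abc-iut-L6-t23,
referee abc-iut-ref-d D5-F11): (1) R-9 finding of abc-iut-L2-t6 (kernel-certified, `FreeMonoidPerfectionRigidity`): v2's
field `perfectionEquiv : Perfection DIVplus ≃* (Cusp ⊕ Comp → ℚ_{≥0})` is unsatisfiable for infinite `Cusp ⊔ Comp`;
replaced by Def. 3.1 (i)'s `divPlusEquiv`, with Prop. 3.2 (i) DERIVED onto the bounded-denominator product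
(`LogDivisorModel.perfectionEquiv`, `perfectionEquiv_nonCuspidal`); (2) author's Comments on [EtTh] (Mar. 2022)
(xvi): uniqueness of the INDEX `i_H` in Def. 3.3 (i)(c) is "false, in general" — v2's field
`TemperedFilter.indexOf_unique` is dropped; the intended statement (uniqueness of `Δ^{fil,∞}_{i_H}`) is PROVED
as `TemperedFilter.closure_indexOf_unique`. No other declaration changed.

## Definition 3.3 (i), (ii) (pp.72–73)

Tempered filters are pure topological group theory and are REAL definitions here
(`TemperedFilter`), over the co-free / minimal co-free notions of §0 (`Conventions.lean`). The
covering-theoretic clauses of (ii) are rendered group-theoretically through the dictionary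
"connected tempered covering `Y^log → X^log` ↔ open subgroup of `Π^tp_X`" of [SemiAnbd] §3; the
tempered fundamental group `Π^tp_X ↠ G_K` is the interface
`Literature.AnabelianGeometry.SemiGraphs.TemperedArithmeticGroup` of
`Literature/AnabelianGeometry/SemiGraphs/TemperedCurves.lean` ([SemiAnbd] Example 3.10, seat
abc-iut-L3-t2), used here directly (its `delta = Ker(aug)` is `Δ^tp_X`). Definition 3.3 (iii) (the
monoids `Φ₀`, `B₀`) is in `DivisorMonoids.lean`.
-/

namespace Literature.AnabelianGeometry.EtaleTheta

open Literature.AlgebraicGeometry.Frobenioids Topology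

universe u

/-! ## Definition 3.1 and Proposition 3.2 (p.70): the interface `LogDivisorModel` -/

/-- **The universal combinatorial covering `Z^log_∞` as an interface** [EtTh §3, pp.69–71].
Data (Definition 3.1, p.70): the group `Fn` of nonzero meromorphic functions on `Z_∞`; the group
`DIV(Z^log_∞)` of *log-divisors* ("a divisor on `Z_∞` whose support lies in the [union of the]
special fiber [and the] divisor of cusps") with the submonoids `DIV⁺` (effective), `Div` (Cartier),
`Div⁺` (effective Cartier) and the predicates *non-cuspidal* (support in the special fibre) /
*cuspidal* (support in the divisor of cusps); the subgroup `Mero(Z^log_∞)` of *log-meromorphic*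
functions ("a nonzero meromorphic function … whose divisor of zeroes and poles is a log-divisor",
(ii)) with its divisor map, and the *constant* ones ("arising from `L^×`"). Hypothesis fields =
Proposition 3.2 (i)–(iii) (p.70, proved in print on p.71) and the elementary compatibilities the
text uses tacitly. ERRATUM E2: see the module docstring and the fields `temperedMero`,
`temperedMero_le_logMero`. [cite: MochizukiEtTh2009, Def 3.1 p.70] -/
structure LogDivisorModel : Type (u + 1) where
  /-- the multiplicative group of nonzero meromorphic functions on `Z_∞` (Def 3.1 (ii), p.70) -/
  Fn : Type u
  /-- group structure -/
  [instCommGroupFn : CommGroup Fn]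
  /-- `DIV(Z^log_∞)`: the group of log-divisors (Def 3.1 (i), p.70; "`DIV(Z^log_∞) = DIV⁺(Z^log_∞)^gp`") -/
  DIV : Type u
  /-- group structure -/
  [instCommGroupDIV : CommGroup DIV]
  /-- `DIV⁺(Z^log_∞)`: effective log-divisors (Def 3.1 (i), p.70) -/
  DIVplus : Submonoid DIV
  /-- `Div(Z^log_∞)`: Cartier log-divisors (Def 3.1 (i), p.70) -/
  Div : Subgroup DIV
  /-- "a natural identification `DIV(Z^log_∞) = DIV⁺(Z^log_∞)^gp`" (p.70): every log-divisor is a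
  difference of effective ones -/
  exists_div_eq : ∀ d : DIV, ∃ a ∈ DIVplus, ∃ b ∈ DIVplus, d * b = a
  /-- effective log-divisors form a sharp monoid (`D` and `-D` effective only for `D = 0`) -/
  eq_one_of_mem_of_inv_mem : ∀ d : DIV, d ∈ DIVplus → d⁻¹ ∈ DIVplus → d = 1
  /-- *non-cuspidal* log-divisors: "whose support lies in the special fiber" (Def 3.1 (i), p.70) -/
  nonCuspidal : Subgroup DIV
  /-- *cuspidal* log-divisors: supported in "the divisor of cusps of `Z^log_∞`" (Def 3.1 (i), p.70) -/
  cuspidal : Subgroup DIV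
  /-- a log-divisor is uniquely the sum of a non-cuspidal and a cuspidal one ("the union of the
  special fiber and divisor of cusps", p.70) -/
  nonCuspidal_isCompl_cuspidal : IsCompl nonCuspidal cuspidal
  /-- the divisor of zeroes and poles of a nonzero meromorphic function, when it is a log-divisor:
  the subgroup `Mero(Z^log_∞)` of *log-meromorphic* functions, printed condition (c) of
  [IUTchI] Rmk 3.2.4 (i) = [EtTh] Def 3.1 (ii), p.70 -/
  logMero : Subgroup Fn
  /-- `f ↦` its log-divisor of zeroes and poles, on `Mero(Z^log_∞)` (Def 3.1 (ii); Def 3.3 (iii), p.73: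
  "given by assigning to a log-meromorphic function its log-divisor of zeroes and poles") -/
  divisor : logMero →* DIV
  /-- principal divisors are Cartier (tacit on p.73, where `B₀ → Φ₀^gp` lands in `Div⁺(…)^gp`) -/
  divisor_mem_Div : ∀ f, divisor f ∈ Div
  /-- the *constant* log-meromorphic functions, "arising from `L^×`" (Def 3.1 (ii), p.70) -/
  const : Subgroup Fn
  /-- constants are log-meromorphic -/
  const_le_logMero : const ≤ logMero
  /-- the constants arising from `O_L^▷ = O_L ∖ {0}` (used in Prop 3.4 (ii), p.74) -/
  intConst : Submonoid Fn
  /-- `O_L^▷ ⊆ L^×` -/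
  intConst_le_const : intConst ≤ const.toSubmonoid
  /-- ERRATUM E2, IUT's condition (a) ([IUTchI] Rmk 3.2.4 (i)(a), kurims p.75): "for every
  `N ∈ ℕ_{≥1}`, it holds that `f` admits an `N`-th root over some tempered covering of `Z^log`"
  (*tempered-meromorphic* functions, loc. cit. (iv)(A)); recorded as a predicate since tempered
  coverings of `Z^log` other than `Z_∞` are outside this interface -/
  temperedMero : Subgroup Fn
  /-- ERRATUM E2: "(a) ⟹ (b) ⟺ (c)" ([IUTchI] Rmk 3.2.4 (i), kurims pp.75–76): tempered-meromorphic
  functions are log-meromorphic; the converse is NOT asserted ("it is not clear to the author …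
  whether or not (c) [or (b)] implies (a)") -/
  temperedMero_le_logMero : temperedMero ≤ logMero
  /-- **Proposition 3.2 (i)** (p.70): "There exists a positive integer `n` such that
  `n · DIV⁺(Z^log_∞) ⊆ Div⁺(Z^log_∞)`, `n · DIV(Z^log_∞) ⊆ Div(Z^log_∞)`" -/
  exists_pow_mem_Div : ∃ n : ℕ+, ∀ d : DIV, d ^ (n : ℕ) ∈ Div
  /-- **Proposition 3.2 (i)**, continued (p.70): index set of "the cusps [i.e., irreducible
  components of the divisor of cusps]" of `Z^log_∞` -/
  Cusp : Type u
  /-- index set of the "irreducible components of the special fiber of `Z^log_∞`" (p.70) -/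
  Comp : Type u
  /-- **Definition 3.1 (i)** (p.70), the structure of `DIV⁺(Z^log_∞)`: an effective log-divisor is an
  `ℕ`-valued function on `Cusp ⊔ Comp` (cusps ⊔ irreducible components of the special fiber; `ℕ` written
  multiplicatively). v3 (R-9 repair, abc-iut-L2-t6 Option B): REPLACES v2's `perfectionEquiv : Perfection
  DIVplus ≃* (Cusp ⊕ Comp → ℚ_{≥0})`, unsatisfiable for infinite `Cusp ⊔ Comp` (`FreeMonoidPerfectionRigidity`);
  Prop. 3.2 (i)'s "direct product of copies of `ℚ_{≥0}`" is DERIVED below (`perfectionEquiv`). -/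
  divPlusEquiv : DIVplus ≃* (Cusp ⊕ Comp → Multiplicative ℕ)
  /-- under this identification non-cuspidal effective divisors are the ones supported on `Comp` -/
  divPlusEquiv_nonCuspidal : ∀ d : DIVplus, (d : DIV) ∈ nonCuspidal ↔
    ∀ c : Cusp, divPlusEquiv d (Sum.inl c) = 1
  /-- **Proposition 3.2 (ii)** (p.70): "the structure morphism `Z^log_∞ → 𝔗` determines a natural
  isomorphism `O_L ≅ Γ(Z_∞, O_{Z_∞})` — i.e., 'all regular functions on `Z_∞` are constant'":
  a log-meromorphic function with effective divisor is a constant from `O_L^▷` -/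
  mem_intConst_of_divisor_mem : ∀ f : logMero, divisor f ∈ DIVplus → (f : Fn) ∈ intConst
  /-- conversely constants from `O_L^▷` have effective (non-cuspidal) divisor -/
  divisor_mem_of_mem_intConst : ∀ f : logMero, (f : Fn) ∈ intConst →
    divisor f ∈ DIVplus ∧ divisor f ∈ nonCuspidal
  /-- units of `O_L` have trivial divisor: `divisor f = 0` iff `f` and `f⁻¹` both come from `O_L^▷` -/
  divisor_eq_one_iff : ∀ f : logMero, divisor f = 1 ↔ (f : Fn) ∈ intConst ∧ (f : Fn)⁻¹ ∈ intConst
  /-- **Proposition 3.2 (iii)** (p.70): "Let `f` be a nonzero meromorphic function on `Z_∞` such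
  that for every `N ∈ ℕ_{≥1}`, there exists a meromorphic function `g_N` on `Z_∞` such that
  `g_N^N = f`. Then `f = 1`." -/
  eq_one_of_forall_exists_pow_eq : ∀ f : Fn, (∀ N : ℕ+, ∃ g : Fn, g ^ (N : ℕ) = f) → f = 1

namespace LogDivisorModel

attribute [instance] LogDivisorModel.instCommGroupFn LogDivisorModel.instCommGroupDIV

variable (Z : LogDivisorModel.{u})

/-- **Proposition 3.2 (i)** (p.70), second clause, now a THEOREM-LEVEL CONSTRUCTION: "`DIV⁺(Z^log_∞)^pf`
may be naturally identified with a direct product of copies of `ℚ_{≥0}`, indexed by the cusps … and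
irreducible components of the special fiber" — read, for an infinite index set, as the
bounded-denominator product `boundedDenom` (abc-iut-L2-t6's `funPerfectionEquiv`; for finite index sets
this IS the full product, `funPerfectionEquivOfFinite`).  Derived from Def. 3.1 (i) (`divPlusEquiv`).
[cite: MochizukiEtTh2009, Prop 3.2 (i) p.70] -/
noncomputable def perfectionEquiv : Perfection Z.DIVplus ≃* boundedDenom (Z.Cusp ⊕ Z.Comp) :=
  (Perfection.congr Z.divPlusEquiv).trans (funPerfectionEquiv _)

/-- Under `perfectionEquiv`, non-cuspidal effective divisors are the ones supported on `Comp` (the v2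
field `perfectionEquiv_nonCuspidal`, now derived). [cite: MochizukiEtTh2009, Prop 3.2 (i) p.70] -/
theorem perfectionEquiv_nonCuspidal (d : Z.DIVplus) :
    (d : Z.DIV) ∈ Z.nonCuspidal ↔
      ∀ c : Z.Cusp, (Z.perfectionEquiv (Perfection.of Z.DIVplus d) : Z.Cusp ⊕ Z.Comp → Multiplicative ℚ≥0)
        (Sum.inl c) = 1 := by
  rw [Z.divPlusEquiv_nonCuspidal d]
  refine forall_congr' fun c => ?_
  have key : (Z.perfectionEquiv (Perfection.of Z.DIVplus d) : Z.Cusp ⊕ Z.Comp → Multiplicative ℚ≥0)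
      (Sum.inl c) = Multiplicative.ofAdd (((Multiplicative.toAdd (Z.divPlusEquiv d (Sum.inl c)) : ℕ) : ℚ≥0) / (1 : ℕ+)) := by
    change funPerfectionHom _ (Perfection.congr Z.divPlusEquiv (Perfection.of Z.DIVplus d)) (Sum.inl c) = _
    rw [Perfection.congr_of]
    exact congrFun (funPerfectionHom_mk _ (Z.divPlusEquiv d) 1) (Sum.inl c)
  rw [key, ← toAdd_eq_zero, ← toAdd_eq_zero, toAdd_ofAdd, PNat.one_coe, Nat.cast_one, div_one,
    Nat.cast_eq_zero]

/-- `Div⁺(Z^log_∞) = Div ∩ DIV⁺`, the effective Cartier log-divisors (Def 3.1 (i), p.70; "natural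
inclusions `Div⁺ ⊆ DIV⁺ ⊆ DIV`, `Div⁺ ⊆ Div ⊆ DIV`"). [cite: MochizukiEtTh2009, Def 3.1 p.70] -/
def Divplus : Submonoid Z.DIV := Z.Div.toSubmonoid ⊓ Z.DIVplus

/-- `Div⁺ ⊆ DIV⁺`. [cite: MochizukiEtTh2009, Def 3.1 p.70] -/
theorem Divplus_le_DIVplus : Z.Divplus ≤ Z.DIVplus := inf_le_right

/-- `Div⁺ ⊆ Div`. [cite: MochizukiEtTh2009, Def 3.1 p.70] -/
theorem Divplus_le_Div : Z.Divplus ≤ Z.Div.toSubmonoid := inf_le_left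

/-- `DIV = (DIV⁺)^gp` in the sense of §0: the group-saturation of `DIV⁺` in `DIV` is everything.
[cite: MochizukiEtTh2009, Def 3.1 p.70] -/
theorem groupSaturation_DIVplus_eq_top : groupSaturation Z.DIVplus = ⊤ :=
  top_le_iff.mp fun d _ => Z.exists_div_eq d

/-- Proposition 3.2 (i), first clause: some positive multiple of every effective log-divisor is an
effective Cartier log-divisor. [cite: MochizukiEtTh2009, Prop 3.2 p.70] -/
theorem exists_pow_mem_Divplus : ∃ n : ℕ+, ∀ d ∈ Z.DIVplus, d ^ (n : ℕ) ∈ Z.Divplus := by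
  obtain ⟨n, hn⟩ := Z.exists_pow_mem_Div
  exact ⟨n, fun d hd => ⟨hn d, Z.DIVplus.pow_mem hd n⟩⟩

/-- Proposition 3.2 (i), "in particular": `Div⁺(Z^log_∞)` is perf-saturated-dense in `DIV⁺`, i.e.
the perf-saturation (§0) of `Div⁺` in `DIV⁺`-elements is all of `DIV⁺` — the content of the natural
isomorphism `Div⁺(Z^log_∞)^pf ≅ DIV⁺(Z^log_∞)^pf`. [cite: MochizukiEtTh2009, Prop 3.2 p.70] -/
theorem DIVplus_le_perfSaturation_Divplus : Z.DIVplus ≤ perfSaturation Z.Divplus := by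
  obtain ⟨n, hn⟩ := Z.exists_pow_mem_Divplus
  exact fun d hd => ⟨n, hn d hd⟩

/-- A constant log-meromorphic function is log-meromorphic (coercion helper).
[cite: MochizukiEtTh2009, Def 3.1 p.70] -/
def constToLogMero : Z.const →* Z.logMero := Subgroup.inclusion Z.const_le_logMero

/-- Proposition 3.2 (iii) for log-meromorphic functions: an infinitely divisible element of
`Mero(Z^log_∞)` is trivial (special case of the printed statement, which allows arbitrary
meromorphic `f`, `g_N`). [cite: MochizukiEtTh2009, Prop 3.2 p.70] -/
theorem logMero_eq_one_of_divisible (f : Z.logMero) (h : ∀ N : ℕ+, ∃ g : Z.logMero, g ^ (N : ℕ) = f) :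
    f = 1 := by
  refine Subtype.ext (Z.eq_one_of_forall_exists_pow_eq f fun N => ?_)
  obtain ⟨g, hg⟩ := h N
  exact ⟨g, by simpa using congrArg Subtype.val hg⟩

end LogDivisorModel

/-! ## Definition 3.3 (i) (p.72): tempered filters — a real definition -/

section TemperedFilters

variable (Δ : Type u) [Group Δ] [TopologicalSpace Δ]

/-- A subgroup is *characteristic* in the topological group `Δ` if every isomorphism of
topological groups `Δ ≃ₜ* Δ` carries it onto itself (the sense of "characteristic" for the
open subgroups of Definition 3.3 (i), p.72). [cite: MochizukiEtTh2009, Def 3.3 p.72] -/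
def IsTopCharacteristic (H : Subgroup Δ) : Prop := ∀ φ : Δ ≃ₜ* Δ, H.map φ.toMulEquiv.toMonoidHom = H

/-- **Definition 3.3 (i)** (p.72): a *tempered filter* on a (tempered) topological group `Δ` is "a
countable collection of characteristic open subgroups of finite index `Δ^fil = {Δ^fil_i}_{i∈I}` of
`Δ` such that: (a) `⋂_{i∈I} Δ^fil_i = {1}`; (b) every `Δ^fil_i` admits a minimal co-free subgroup
`Δ^{fil,∞}_i` [necessarily characteristic in `Δ`]; (c) for each open subgroup `H ⊆ Δ`, there exists
a [necessarily unique] `i_H ∈ I` such that `Δ^{fil,∞}_{i_H} ⊆ H`, and, moreover, for every `i ∈ I`,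
`Δ^{fil,∞}_i ⊆ H` implies `Δ^{fil,∞}_i ⊆ Δ^{fil,∞}_{i_H}`." The minimal co-free subgroups of (b)
(unique by `IsMinimalCofree.unique`) and the indices of (c) are carried as data `closure`,
`indexOf` with their defining properties. Stated for any topological group `Δ`; print assumes `Δ`
tempered (tree: `Literature.AnabelianGeometry.SemiGraphs.IsTempered`).
[cite: MochizukiEtTh2009, Def 3.3 p.72] -/
structure TemperedFilter : Type (u + 1) where
  /-- the index set `I` -/
  I : Type u
  /-- "a countable collection" -/
  [countable : Countable I]
  /-- the subgroups `Δ^fil_i` -/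
  fil : I → Subgroup Δ
  /-- each `Δ^fil_i` is open -/
  isOpen_fil : ∀ i, IsOpen (fil i : Set Δ)
  /-- each `Δ^fil_i` has finite index -/
  finiteIndex_fil : ∀ i, (fil i).FiniteIndex
  /-- each `Δ^fil_i` is characteristic -/
  isTopCharacteristic_fil : ∀ i, IsTopCharacteristic Δ (fil i)
  /-- (a) `⋂_i Δ^fil_i = {1}` -/
  iInf_fil : ⨅ i, fil i = ⊥
  /-- (b) the minimal co-free subgroup `Δ^{fil,∞}_i` of `Δ^fil_i`, as a subgroup of `Δ` -/
  closure : I → Subgroup Δ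
  /-- `Δ^{fil,∞}_i ⊆ Δ^fil_i` -/
  closure_le : ∀ i, closure i ≤ fil i
  /-- `Δ^{fil,∞}_i` is normal in `Δ^fil_i` -/
  normal_closure : ∀ i, ((closure i).subgroupOf (fil i)).Normal
  /-- (b) `Δ^{fil,∞}_i` is a minimal co-free subgroup of the topological group `Δ^fil_i` -/
  isMinimalCofree_closure : ∀ i, @IsMinimalCofree (fil i) _ _ _ (normal_closure i)
  /-- (c) the index `i_H` attached to an open subgroup `H ⊆ Δ` -/
  indexOf : OpenSubgroup Δ → I
  /-- (c) `Δ^{fil,∞}_{i_H} ⊆ H` -/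
  closure_indexOf_le : ∀ H : OpenSubgroup Δ, closure (indexOf H) ≤ (H : Subgroup Δ)
  /-- (c) "for every `i ∈ I`, `Δ^{fil,∞}_i ⊆ H` implies `Δ^{fil,∞}_i ⊆ Δ^{fil,∞}_{i_H}`" -/
  closure_le_closure_indexOf : ∀ (H : OpenSubgroup Δ) (i : I),
    closure i ≤ (H : Subgroup Δ) → closure i ≤ closure (indexOf H)

namespace TemperedFilter

attribute [instance] TemperedFilter.countable

variable {Δ}
variable (F : TemperedFilter Δ)

/-- "In the situation of (c), we shall refer to `Δ^{fil,∞}_{i_H}` as the *`Δ^fil`-closure* of `H`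
in `Δ`" (Def 3.3 (i), p.72). [cite: MochizukiEtTh2009, Def 3.3 p.72] -/
def filClosure (H : OpenSubgroup Δ) : Subgroup Δ := F.closure (F.indexOf H)

/-- The `Δ^fil`-closure of `H` is contained in `H`. [cite: MochizukiEtTh2009, Def 3.3 p.72] -/
theorem filClosure_le (H : OpenSubgroup Δ) : F.filClosure H ≤ (H : Subgroup Δ) :=
  F.closure_indexOf_le H

/-- **Definition 3.3 (i) (c), the author's CORRECTED uniqueness clause** (Comments on [EtTh], Mar. 2022, (xvi):
"the assertion that '`i_H ∈ I` is necessarily unique' is false, in general. The intended assertion … is that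
'`Δ^{fil,∞}_{i_H} ⊆ H` is necessarily unique'") — PROVED from (c): any `j` with `Δ^{fil,∞}_j ⊆ H` maximal among
such has `Δ^{fil,∞}_j = Δ^{fil,∞}_{i_H}`. v3: REPLACES v2's structure field `indexOf_unique` (the retracted 2009
bracket "[necessarily unique]" on `i_H`). [cite: MochizukiEtTh2009, Def 3.3 (i)(c) p.72; Comments (Mar 2022) (xvi)] -/
theorem closure_indexOf_unique (H : OpenSubgroup Δ) (j : F.I) (hj : F.closure j ≤ (H : Subgroup Δ))
    (hmax : ∀ i, F.closure i ≤ (H : Subgroup Δ) → F.closure i ≤ F.closure j) :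
    F.closure j = F.filClosure H :=
  le_antisymm (F.closure_le_closure_indexOf H j hj) (hmax _ (F.closure_indexOf_le H))

/-- The `Δ^fil`-closure of `H` is the largest `Δ^{fil,∞}_i` contained in `H`.
[cite: MochizukiEtTh2009, Def 3.3 p.72] -/
theorem closure_le_filClosure {H : OpenSubgroup Δ} {i : F.I} (h : F.closure i ≤ (H : Subgroup Δ)) :
    F.closure i ≤ F.filClosure H :=
  F.closure_le_closure_indexOf H i h

/-- (b) "[which is necessarily characteristic as a subgroup of `Δ`]" — here in the weaker form
that is immediate from the definitions: `Δ^{fil,∞}_i` is carried to itself by every topological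
automorphism of `Δ^fil_i` (minimal co-free subgroups are characteristic, §0 p.9).
[cite: MochizukiEtTh2009, Def 3.3 p.72] -/
theorem closure_map_eq (i : F.I) (φ : F.fil i ≃ₜ* F.fil i) :
    ((F.closure i).subgroupOf (F.fil i)).map φ.toMulEquiv.toMonoidHom =
      (F.closure i).subgroupOf (F.fil i) :=
  @IsMinimalCofree.map_eq_of_continuousMulEquiv _ _ _ _ (F.normal_closure i)
    (F.isMinimalCofree_closure i) φ

end TemperedFilter

end TemperedFilters

/-! ## Definition 3.3 (ii) (pp.72–73): tempered filters on `X^log`, `Δ^fil`-coverings and closures -/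

variable {K : Type u} [Field K] (X : SemiGraphs.TemperedArithmeticGroup K)

/-- **Definition 3.3 (ii)** (p.72): "We shall refer to a tempered filter on `Δ^tp_X` as a *tempered
filter on `X^log`*" — `Δ^tp_X = Ker(Π^tp_X ↠ G_K)` being `TemperedArithmeticGroup.delta` of the
[SemiAnbd] Example 3.10 interface. [cite: MochizukiEtTh2009, Def 3.3 p.72] -/
abbrev TemperedFilterOn := TemperedFilter X.delta

variable {X}

/-- The geometric part `H ∩ Δ^tp_X` of an open subgroup `H ⊆ Π^tp_X` (the open subgroup of
`Δ^tp_X` "determined by [the geometric portion of]" the corresponding connected tempered covering,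
Def 3.3 (ii), pp.72–73), as an open subgroup of `Δ^tp_X`. [cite: MochizukiEtTh2009, Def 3.3 p.73] -/
noncomputable def geometricPart (H : OpenSubgroup X.Pi) : OpenSubgroup X.delta :=
  ⟨(H : Subgroup X.Pi).subgroupOf X.delta, H.isOpen.preimage continuous_subtype_val⟩

/-- **Definition 3.3 (ii)**, `Δ^fil`-coverings (pp.72–73), group-theoretically: an open subgroup
`J ⊆ Π^tp_X` is (the subgroup of) a *`Δ^fil`-covering* `Z^log_∞ → X^log` attached to the index `i`
if its geometric part is `Δ^{fil,∞}_i` — "`Z^log_∞ → Z^log` corresponds to the subgroup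
`Δ^{fil,∞}_i ⊆ Δ^tp_X`", `Z^log → X^log` being "a finite étale Galois covering that admits a stable
model … such that the special fiber … is split, and … the open subgroup determined by the
[geometric portion of] this covering is equal to … `Δ^fil_i`". The stable-model and base-field
clauses are not group-theoretic and are not recorded (the text: "the geometric portion — but not
the base field! — … is uniquely determined up to isomorphism"). [cite: MochizukiEtTh2009, Def 3.3 p.73] -/
@[mk_iff] structure IsFilCovering (F : TemperedFilterOn X) (i : F.I) (J : OpenSubgroup X.Pi) : Prop where
  /-- the geometric part of `J` is `Δ^{fil,∞}_i` -/
  geometricPart_eq : (geometricPart J : Subgroup X.delta) = F.closure i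

/-- **Definition 3.3 (ii)**, `Δ^fil`-closures (p.73): for a connected tempered covering
`Y^log → X^log` with open subgroup `H_Y ⊆ Π^tp_X` and geometric part `H`, "any covering
`Z^log_∞ → Y^log` whose composite with `Y^log → X^log` is the [`Δ^fil`-]covering `Z^log_∞ → X^log`
[attached to `i_H`]" is a *`Δ^fil`-closure* of `Y^log → X^log`: an open subgroup `J ⊆ H_Y` which
is a `Δ^fil`-covering for the index `i_H` of the `Δ^fil`-closure of `H`.
[cite: MochizukiEtTh2009, Def 3.3 p.73] -/
@[mk_iff] structure IsFilClosure (F : TemperedFilterOn X) (HY J : OpenSubgroup X.Pi) : Prop where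
  /-- `Z^log_∞ → Y^log`: `J ⊆ H_Y` -/
  le : (J : Subgroup X.Pi) ≤ HY
  /-- the composite `Z^log_∞ → X^log` is the `Δ^fil`-covering attached to `i_H` -/
  isFilCovering : IsFilCovering F (F.indexOf (geometricPart HY)) J

/-- The geometric part of a `Δ^fil`-closure of `Y^log → X^log` is the `Δ^fil`-closure of the
geometric part of `H_Y` ("the geometric portion … of a `Δ^fil`-closure … is uniquely determined",
p.73). [cite: MochizukiEtTh2009, Def 3.3 p.73] -/
theorem IsFilClosure.geometricPart_eq {F : TemperedFilterOn X} {HY J : OpenSubgroup X.Pi}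
    (h : IsFilClosure F HY J) :
    (geometricPart J : Subgroup X.delta) = F.filClosure (geometricPart HY) :=
  h.isFilCovering.geometricPart_eq

/-! ### Remark 3.3.2 (p.74) — documentation
"Note that by taking the extension field `K'` used to define the stack structure of `𝔖` to be
'sufficiently large', one may treat the case in which `X^log` fails to have stable reduction over
`O_K`. Moreover, although at first sight the choice of `K'` may appear to be somewhat arbitrary,
one verifies immediately that the category `D₀`, as well as the monoids `Φ₀`, `B₀` on `D₀`, are
unaffected by replacing `K'` by some larger finite Galois extension of `K`." In the present typing
`K'` does not occur (the tempered group and the log-divisor models are interfaces), so no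
declaration is made for this remark. -/

end Literature.AnabelianGeometry.EtaleTheta
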